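import Summits.QuantumFields.BalabanUV.T4Continuum.Support.NE7LatticeLandauMinimiser
import HarnessLib

/-!
# T⁴ programme, row NE7 — (161b) THE EXACT LATTICE LANDAU GAUGE, FILE 2∕2 — THE EULER–LAGRANGE EQUATION AT EVERY SITE: the TRACE link functional
# `u ↦ Σ_{b} (1 − Re tr U^{u}(b))` attains its minimum over the unitary periodic gauges with ONE-POINT normalisation `u(0) = 1`,
# and every minimiser satisfies the lattice Landau condition `Σ_κ [S(z,κ) − S(z−e_κ,κ)] = 0` AT EVERY SITE, `S = W − Wᴴ`, `W = U^{u}`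
# (`NE7LatticeLandauEuler`, over file 1∕2 `NE7LatticeLandauMinimiser`)

Cell `pub-balaban`, rung (B)+1 sub-cell t4, row NE7.  Lineage `b2b-balaban-t4-ne7-p2` (CRUX PROVER NE7 #2 = co-owner of row NE7), generation 88;
companion to (158b) `NE7GradientCurrencyLandauEL` (the gradient currency with the reaction in Euler–Lagrange form) and to the memo
`t4/b2b-balaban-t4-ne7-p2/g88/REPFLAT-GRADIENT-LINE.md` §3 (F2)(a) ∕ §5.

WHY.  After (159) THE END at the trivial flat datum asks of B8's representative `W = U^{u₀} = e^{A₀}` the SUP currency `a₀` and the SMOOTHNESS OF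
THE LANDAU REACTION `r` ((158b): `r` bounds the forward differences of `Σ_κ [S(x,κ) − S(x−e_κ,κ)]`, `S = (W − W⁻¹)∕2`).  The OWNER's N3a
`NE7LinkFunctionalMinimiser.exists_linkMinimiser` minimises the OPERATOR-norm functional `Σ‖U^u(b) − 1‖²` over gauges pinned at EVERY block corner
(`u(M•y) = 1 ∀y`): that functional is not differentiable and that class produces lattice Coulomb spikes (memo §5: sup|∇A|·M² grows ≈ linearly in M).
THIS FILE gives the classical object instead: the minimiser of the TRACE functional `F_U(u) = Σ_{x ∈ periodBox P} Σ_κ (1 − Re tr U^{u}(x,κ))` (the lattice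
Landau gauge of lattice gauge theory) over `{u : unitary, P-periodic, u(0) = 1}` EXISTS (compactness, as N3a) and satisfies its Euler–Lagrange equation
— the lattice Landau condition on the odd part of the links — at EVERY site: at the free sites by the first variation along `u_t = e^{tλ}·u`, `λ` a skew
matrix placed on one residue class, and at the pinned class by the torus divergence theorem `Σ_{x ∈ periodBox} div S = 0`.  So the reaction of (158b)
VANISHES IDENTICALLY for this representative (`r = 0`): of REP♭ there then remain the sup letter `a₀` of THIS representative (+ its top re-gauging) and
the (1.9) input `j` (the OWNER's R1–R4).

WHAT, FILE 2∕2 ([folklore]; 0 def, 0 sorry; file 1∕2 = existence + bookkeeping):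
* §3 `hasDerivAt_traceLink_expGauge` (first variation of `F_U` along `e^{tλ}·u`), **`landau_of_isMin`** — a minimiser satisfies
  `Σ_κ [(W(z,κ) − W(z,κ)ᴴ) − (W(z−e_κ,κ) − W(z−e_κ,κ)ᴴ)] = 0` at EVERY `z` (for `P`-periodic `U`), and **`exists_latticeLandauGauge`** (§2 + §3).

HONEST FRAMING (page 1): elementary (compactness + one-variable calculus + torus bookkeeping); existence and the Euler–Lagrange equation ONLY — the sup
letter `a₀` of this representative (N- and k-uniform) is NOT proved and is the crux (memo §3); nothing of Bałaban's asserted ([Balaban1985RegularSpaces]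
reaches its Landau gauge by a contraction, not by minimisation); (APE) NOT proved; NE7 NOT PRINTED ∕ NOT PROVED; spine 0∕9; finite T⁴ rung (B)+1 — NOT
infinite volume, NOT mass gap, NOT Clay.  Continuum YM on T⁴ ⇐ BetaPertH ∧ nine spine estimates (0/9 proved); BetaPertH ⇐ (D1) ∧ (D4) ∧ CAP+tail;
G-an2-4 gates asym, D1 and NE2/3/4.  No `sorry`.  PLACEMENT: our lemma, under `Summits/QuantumFields/BalabanUV/`.
-/

set_option autoImplicit false

open scoped BigOperators Matrix Matrix.Norms.L2Operator
open NormedSpace Finset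

namespace Summit.QuantumFields.BalabanUV.T4Continuum.NE7LatticeLandauEuler

open Literature.MathematicalPhysics.QuantumFieldTheory.Balaban1983to89
open B7Prop1Explicit B7Prop2Explicit MatrixNorms UnitaryModel
open T4AveragingDeficitWall (nReTrL nReTrL_apply hasDerivAt_exp_smul_zero hasDerivAt_exp_neg_smul_zero)
open T4AveragingDeficitWallBoundary (IsPeriodicCfg periodBox mem_periodBox)
open AveragingDeficitTorusChart (redN redN_add_smul periodic_smul_vec)
open SkeletonLattice (cdiv cmod smul_cdiv_add_cmod cmod_nonneg cmod_lt cmod_eq_of_repr)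
open NE3HilbertSchmidtTorus (HSMat Sec extS resS extS_resS extS_boxVec extS_add_period)
open NE3HilbertSchmidtTorus.HSMat (toHS ofHS)
open NE7LinkFunctionalMinimiser (continuous_extS_apply norm_sq_le_one_of_unitary)
open BlockAveragePushDirGauge (expGauge expGauge_zero val_gaugeAct_expGauge gaugeAct_const_one)
open NE3CovariantCalculus (hsR hsR_self)
open NE3LandauOrbit (eq_zero_of_nhsNormSq_eq_zero)
open NE3HessBounds (nReTr_mul_comm)
open B8Eq115GaugeFixing (gaugeAct_mul)
open NE7LatticeLandauMinimiser (nReTr_skew_eq_zero cmod_mem_periodBox cmod_eq_self_of_mem cmod_add_zsmul cmod_cmod_add apply_cmod_of_periodic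
  sum_periodBox_shift_vec exists_traceLinkMinimiser)

noncomputable section

variable {d : ℕ} {n : Type*} [Fintype n] [DecidableEq n]

/-! ## §3 The Euler–Lagrange equation: the lattice Landau condition at every site -/

/-- **FIRST VARIATION OF THE TRACE LINK FUNCTIONAL ALONG `u_t = e^{tλ}·u`**: with `W = U^{u}`,
`d∕dt|₀ Σ_{x,κ} (1 − Re tr W^{e^{tλ}}(x,κ)) = −Σ_{x,κ} Re tr(λ(x)W(x,κ) − W(x,κ)λ(x+e_κ))`. [folklore] -/
theorem hasDerivAt_traceLink_expGauge [Nonempty n] (P : ℕ) (W : Site d → Fin d → (Matrix n n ℂ)ˣ) (lam : Site d → Matrix n n ℂ) :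
    HasDerivAt (fun t : ℝ => ∑ x ∈ periodBox (d := d) P, ∑ κ : Fin d,
        (1 - nReTr ((gaugeAct (expGauge lam t) W x κ : (Matrix n n ℂ)ˣ) : Matrix n n ℂ)))
      (-(∑ x ∈ periodBox (d := d) P, ∑ κ : Fin d,
        nReTr (lam x * ((W x κ : (Matrix n n ℂ)ˣ) : Matrix n n ℂ) - ((W x κ : (Matrix n n ℂ)ˣ) : Matrix n n ℂ) * lam (x + e κ)))) 0 := by
  have hterm : ∀ (x : Site d) (κ : Fin d), HasDerivAt (fun t : ℝ => (1 - nReTr ((gaugeAct (expGauge lam t) W x κ : (Matrix n n ℂ)ˣ) : Matrix n n ℂ)))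
      (-(nReTr (lam x * ((W x κ : (Matrix n n ℂ)ˣ) : Matrix n n ℂ) - ((W x κ : (Matrix n n ℂ)ˣ) : Matrix n n ℂ) * lam (x + e κ)))) 0 := by
    intro x κ
    have h1 := ((hasDerivAt_exp_smul_zero (lam x)).mul_const ((W x κ : (Matrix n n ℂ)ˣ) : Matrix n n ℂ)).mul
      (hasDerivAt_exp_neg_smul_zero (lam (x + e κ)))
    have h2 : HasDerivAt (fun t : ℝ => ((gaugeAct (expGauge lam t) W x κ : (Matrix n n ℂ)ˣ) : Matrix n n ℂ))
        (lam x * ((W x κ : (Matrix n n ℂ)ˣ) : Matrix n n ℂ) - ((W x κ : (Matrix n n ℂ)ˣ) : Matrix n n ℂ) * lam (x + e κ)) 0 := by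
      have h3 : (fun t : ℝ => ((gaugeAct (expGauge lam t) W x κ : (Matrix n n ℂ)ˣ) : Matrix n n ℂ))
          = fun t : ℝ => exp ((t : ℂ) • lam x) * ((W x κ : (Matrix n n ℂ)ˣ) : Matrix n n ℂ) * exp (-((t : ℂ) • lam (x + e κ))) := by
        funext t; exact val_gaugeAct_expGauge W lam t x κ
      rw [h3]
      refine h1.congr_deriv ?_
      simp only [Complex.ofReal_zero, zero_smul, neg_zero, exp_zero, one_mul, mul_one]
      noncomm_ring
    have h4 := ((nReTrL (n := n)).hasFDerivAt.comp_hasDerivAt (0 : ℝ) h2).const_sub 1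
    simpa [Function.comp_def] using h4
  have hsum : HasDerivAt (fun t : ℝ => ∑ x ∈ periodBox (d := d) P, ∑ κ : Fin d,
        (1 - nReTr ((gaugeAct (expGauge lam t) W x κ : (Matrix n n ℂ)ˣ) : Matrix n n ℂ)))
      (∑ x ∈ periodBox (d := d) P, ∑ κ : Fin d,
        -(nReTr (lam x * ((W x κ : (Matrix n n ℂ)ˣ) : Matrix n n ℂ) - ((W x κ : (Matrix n n ℂ)ˣ) : Matrix n n ℂ) * lam (x + e κ)))) 0 :=
    HasDerivAt.fun_sum fun x _ => HasDerivAt.fun_sum fun κ _ => hterm x κ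
  refine hsum.congr_deriv ?_
  simp only [Finset.sum_neg_distrib]

/-- **A MINIMISER OF THE TRACE LINK FUNCTIONAL SATISFIES THE LATTICE LANDAU CONDITION AT EVERY SITE.**  For `P ≥ 1`, a `P`-periodic `U`, and `u` unitary
`P`-periodic with `u 0 = 1` minimising `F_U` over that class: with `W = U^{u}`, at EVERY site `z`
`Σ_κ [(W(z,κ) − W(z,κ)ᴴ) − (W(z−e_κ,κ) − W(z−e_κ,κ)ᴴ)] = 0` — at the free residue classes by the first variation along a skew matrix placed on the class
(Fermat + `nReTr_skew_eq_zero`), at the pinned class `z ≡ 0` by the torus divergence theorem. [folklore] -/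
theorem landau_of_isMin [Nonempty n] {P : ℕ} (hP : 1 ≤ P) {U : Site d → Fin d → (Matrix n n ℂ)ˣ} (hUP : IsPeriodicCfg U (P : ℤ))
    {u : Site d → (Matrix n n ℂ)ˣ} (hu : ∀ x, u x ∈ unitaryUnits (Matrix n n ℂ)) (huP : ∀ (x : Site d) (τ : Fin d), u (x + (P : ℤ) • e τ) = u x)
    (hu0 : u 0 = 1)
    (hmin : ∀ v : Site d → (Matrix n n ℂ)ˣ, (∀ x, v x ∈ unitaryUnits (Matrix n n ℂ)) → (∀ (x : Site d) (τ : Fin d), v (x + (P : ℤ) • e τ) = v x) →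
        v 0 = 1 →
        ∑ x ∈ periodBox (d := d) P, ∑ κ : Fin d, (1 - nReTr ((gaugeAct u U x κ : (Matrix n n ℂ)ˣ) : Matrix n n ℂ))
          ≤ ∑ x ∈ periodBox (d := d) P, ∑ κ : Fin d, (1 - nReTr ((gaugeAct v U x κ : (Matrix n n ℂ)ˣ) : Matrix n n ℂ)))
    (z : Site d) :
    ∑ κ : Fin d, ((((gaugeAct u U z κ : (Matrix n n ℂ)ˣ) : Matrix n n ℂ) - ((gaugeAct u U z κ : (Matrix n n ℂ)ˣ) : Matrix n n ℂ)ᴴ)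
      - (((gaugeAct u U (z - e κ) κ : (Matrix n n ℂ)ˣ) : Matrix n n ℂ) - ((gaugeAct u U (z - e κ) κ : (Matrix n n ℂ)ˣ) : Matrix n n ℂ)ᴴ)) = 0 := by
  classical
  haveI : NeZero P := ⟨by omega⟩
  set W : Site d → Fin d → (Matrix n n ℂ)ˣ := gaugeAct u U with hW
  have hWP : ∀ (x : Site d) (τ : Fin d) (κ : Fin d), W (x + (P : ℤ) • e τ) κ = W x κ := by
    intro x τ κ
    simp only [hW, gaugeAct]
    rw [huP x τ, hUP x τ κ, add_right_comm, huP (x + e κ) τ]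
  -- the divergence of the odd part as a site function, and its periodicity
  set Dv : Site d → Matrix n n ℂ := fun y => ∑ κ : Fin d, (((W y κ : (Matrix n n ℂ)ˣ) : Matrix n n ℂ) - ((W (y - e κ) κ : (Matrix n n ℂ)ˣ) : Matrix n n ℂ))
    with hDv
  have hDvP : ∀ (y : Site d) (τ : Fin d), Dv (y + (P : ℤ) • e τ) = Dv y := by
    intro y τ
    simp only [hDv]
    refine Finset.sum_congr rfl fun κ _ => ?_
    rw [hWP, show y + (P : ℤ) • e τ - e κ = (y - e κ) + (P : ℤ) • e τ by abel, hWP]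
  -- STEP 1: the free classes.  For `z` with `cmod P z ≠ 0`: `Re tr (X · Dv z) = 0` for every skew `X`.
  have hfree : ∀ y : Site d, cmod P y ≠ 0 → ∀ X : Matrix n n ℂ, X ∈ skewAdjoint (Matrix n n ℂ) → nReTr (X * Dv y) = 0 := by
    intro y hy X hX
    -- the variation `λ = X` on the residue class of `y`, `0` elsewhere
    let lam : Site d → Matrix n n ℂ := fun x => if cmod P x = cmod P y then X else 0
    have hlamP : ∀ (x : Site d) (τ : Fin d), lam (x + (P : ℤ) • e τ) = lam x := by
      intro x τ; simp only [lam, cmod_add_zsmul hP]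
    have hlam_skew : ∀ x, lam x ∈ skewAdjoint (Matrix n n ℂ) := by
      intro x; by_cases h : cmod P x = cmod P y
      · simp only [lam, h, if_true]; exact hX
      · simp only [lam, h, if_false]; exact (skewAdjoint (Matrix n n ℂ)).zero_mem
    have hlam0 : lam 0 = 0 := by
      have h0 : cmod P (0 : Site d) = 0 := cmod_eq_self_of_mem ((mem_periodBox).2 fun κ => ⟨le_rfl, by show (0 : ℤ) < (P : ℤ); exact_mod_cast hP⟩)
      simp only [lam, h0]
      rw [if_neg (Ne.symm hy)]
    -- the competitors `v_t = e^{tλ}·u`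
    let v : ℝ → Site d → (Matrix n n ℂ)ˣ := fun t => expGauge lam t * u
    have hvu : ∀ t x, v t x ∈ unitaryUnits (Matrix n n ℂ) := by
      intro t x
      have h1 : expGauge lam t x ∈ unitaryUnits (Matrix n n ℂ) := by
        rw [mem_unitaryUnits]
        have hskew : (t : ℂ) • lam x ∈ skewAdjoint (Matrix n n ℂ) := by rw [Complex.coe_smul]; exact skewAdjoint.smul_mem t (hlam_skew x)
        letI : NormedAlgebra ℚ (Matrix n n ℂ) := NormedAlgebra.restrictScalars ℚ ℝ (Matrix n n ℂ)
        exact NormedSpace.exp_mem_unitary_of_mem_skewAdjoint hskew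
      exact (unitaryUnits (Matrix n n ℂ)).mul_mem h1 (hu x)
    have hvP : ∀ t (x : Site d) (τ : Fin d), v t (x + (P : ℤ) • e τ) = v t x := by
      intro t x τ; simp only [v, Pi.mul_apply, expGauge, hlamP, huP]
    have hv0 : ∀ t, v t 0 = 1 := by
      intro t; simp only [v, Pi.mul_apply, expGauge, hlam0, smul_zero, hu0, mul_one]; exact Units.ext (by simp)
    -- the function of `t` has a minimum at `0`
    have hlocmin : IsLocalMin (fun t : ℝ => ∑ x ∈ periodBox (d := d) P, ∑ κ : Fin d,
        (1 - nReTr ((gaugeAct (expGauge lam t) W x κ : (Matrix n n ℂ)ˣ) : Matrix n n ℂ))) 0 := by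
      refine Filter.Eventually.of_forall fun t => ?_
      have e0 : gaugeAct (expGauge lam 0) W = W := by rw [expGauge_zero, gaugeAct_const_one]
      have et : gaugeAct (expGauge lam t) W = gaugeAct (v t) U := by
        show gaugeAct (expGauge lam t) W = gaugeAct (expGauge lam t * u) U
        rw [gaugeAct_mul, ← hW]
      show (∑ x ∈ periodBox (d := d) P, ∑ κ : Fin d, (1 - nReTr ((gaugeAct (expGauge lam 0) W x κ : (Matrix n n ℂ)ˣ) : Matrix n n ℂ)))
        ≤ ∑ x ∈ periodBox (d := d) P, ∑ κ : Fin d, (1 - nReTr ((gaugeAct (expGauge lam t) W x κ : (Matrix n n ℂ)ˣ) : Matrix n n ℂ))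
      rw [e0, et]
      exact hmin (v t) (hvu t) (hvP t) (hv0 t)
    have hder := hasDerivAt_traceLink_expGauge P W lam
    have hzero := hlocmin.hasDerivAt_eq_zero hder
    rw [neg_eq_zero] at hzero
    -- evaluate the sum: only the class of `y` contributes
    have hsplit : ∑ x ∈ periodBox (d := d) P, ∑ κ : Fin d,
        nReTr (lam x * ((W x κ : (Matrix n n ℂ)ˣ) : Matrix n n ℂ) - ((W x κ : (Matrix n n ℂ)ˣ) : Matrix n n ℂ) * lam (x + e κ))
        = ∑ κ : Fin d, (nReTr (X * ((W (cmod P y) κ : (Matrix n n ℂ)ˣ) : Matrix n n ℂ))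
            - nReTr (((W (cmod P (y - e κ)) κ : (Matrix n n ℂ)ˣ) : Matrix n n ℂ) * X)) := by
      rw [Finset.sum_comm]
      refine Finset.sum_congr rfl fun κ _ => ?_
      have hA : ∀ x ∈ periodBox (d := d) P, nReTr (lam x * ((W x κ : (Matrix n n ℂ)ˣ) : Matrix n n ℂ) - ((W x κ : (Matrix n n ℂ)ˣ) : Matrix n n ℂ) * lam (x + e κ))
          = (if cmod P y = x then nReTr (X * ((W x κ : (Matrix n n ℂ)ˣ) : Matrix n n ℂ)) else 0)
            - (if cmod P (y - e κ) = x then nReTr (((W x κ : (Matrix n n ℂ)ˣ) : Matrix n n ℂ) * X) else 0) := by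
        intro x hx
        have hxc : cmod P x = x := cmod_eq_self_of_mem hx
        have e1 : lam x = if cmod P y = x then X else 0 := by
          simp only [lam, hxc]; by_cases h : x = cmod P y
          · rw [if_pos h, if_pos h.symm]
          · rw [if_neg h, if_neg (Ne.symm h)]
        have e2 : lam (x + e κ) = if cmod P (y - e κ) = x then X else 0 := by
          simp only [lam]
          by_cases h : cmod P (y - e κ) = x
          · rw [if_pos h, if_pos]
            rw [← h, cmod_cmod_add hP, sub_add_cancel]
          · rw [if_neg h, if_neg]
            intro h2
            apply h
            calc cmod P (y - e κ) = cmod P (cmod P y + -e κ) := by rw [cmod_cmod_add hP, ← sub_eq_add_neg]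
              _ = cmod P (cmod P (x + e κ) + -e κ) := by rw [h2]
              _ = x := by rw [cmod_cmod_add hP, ← sub_eq_add_neg, add_sub_cancel_right, hxc]
        rw [e1, e2]
        unfold nReTr
        split_ifs <;> simp [Matrix.trace_sub, sub_div, neg_div]
      rw [Finset.sum_congr rfl hA, Finset.sum_sub_distrib, Finset.sum_ite_eq, Finset.sum_ite_eq, if_pos (cmod_mem_periodBox hP _),
        if_pos (cmod_mem_periodBox hP _)]
    rw [hsplit] at hzero
    -- periodicity of `W` removes the `cmod`s; cyclicity moves `X` to the left
    have hWc : ∀ (x : Site d) (κ : Fin d), W (cmod P x) κ = W x κ := fun x κ =>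
      apply_cmod_of_periodic (f := fun x' => W x' κ) (fun x' τ => hWP x' τ κ) x
    simp only [hWc, ← nReTr_mul_comm X] at hzero
    have : X * Dv y = ∑ κ : Fin d, (X * ((W y κ : (Matrix n n ℂ)ˣ) : Matrix n n ℂ) - X * ((W (y - e κ) κ : (Matrix n n ℂ)ˣ) : Matrix n n ℂ)) := by
      simp only [hDv, Finset.mul_sum, mul_sub]
    rw [this]
    unfold nReTr at hzero ⊢
    rw [Matrix.trace_sum, Complex.re_sum, Finset.sum_div]
    simpa only [Matrix.trace_sub, Complex.sub_re, sub_div] using hzero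
  -- STEP 2: conclusion at the free classes
  have hfreeD : ∀ y : Site d, cmod P y ≠ 0 → Dv y - (Dv y)ᴴ = 0 := fun y hy => nReTr_skew_eq_zero (hfree y hy)
  -- STEP 3: the pinned class by the torus divergence theorem
  have htot : ∑ x ∈ periodBox (d := d) P, (Dv x - (Dv x)ᴴ) = 0 := by
    have h1 : ∑ x ∈ periodBox (d := d) P, Dv x = 0 := by
      simp only [hDv]
      rw [Finset.sum_comm]
      refine Finset.sum_eq_zero fun κ _ => ?_
      rw [Finset.sum_sub_distrib]
      have hs := sum_periodBox_shift_vec hP (g := fun x => ((W x κ : (Matrix n n ℂ)ˣ) : Matrix n n ℂ)) (fun x τ => by simp only [hWP]) (-e κ)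
      simp only [← sub_eq_add_neg] at hs
      rw [hs, sub_self]
    rw [Finset.sum_sub_distrib, ← Matrix.conjTranspose_sum, h1, Matrix.conjTranspose_zero, sub_zero]
  have hpin0 : Dv 0 - (Dv 0)ᴴ = 0 := by
    have h0mem : (0 : Site d) ∈ periodBox (d := d) P := (mem_periodBox).2 fun κ => ⟨le_rfl, by show (0 : ℤ) < (P : ℤ); exact_mod_cast hP⟩
    rw [← Finset.add_sum_erase _ _ h0mem] at htot
    have hrest : ∑ x ∈ (periodBox (d := d) P).erase 0, (Dv x - (Dv x)ᴴ) = 0 := by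
      refine Finset.sum_eq_zero fun x hx => hfreeD x ?_
      obtain ⟨hx0, hxm⟩ := Finset.mem_erase.1 hx
      rw [cmod_eq_self_of_mem hxm]; exact hx0
    rw [hrest, add_zero] at htot
    exact htot
  -- assemble: `z` is either pinned (`cmod P z = 0`) or free
  have hgoal : Dv z - (Dv z)ᴴ = 0 := by
    by_cases hz : cmod P z = 0
    · have hcz : Dv (cmod P z) = Dv z := apply_cmod_of_periodic hDvP z
      rw [hz] at hcz
      rw [← hcz]; exact hpin0
    · exact hfreeD z hz
  have hre : Dv z - (Dv z)ᴴ = ∑ κ : Fin d, ((((W z κ : (Matrix n n ℂ)ˣ) : Matrix n n ℂ) - ((W z κ : (Matrix n n ℂ)ˣ) : Matrix n n ℂ)ᴴ)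
      - (((W (z - e κ) κ : (Matrix n n ℂ)ˣ) : Matrix n n ℂ) - ((W (z - e κ) κ : (Matrix n n ℂ)ˣ) : Matrix n n ℂ)ᴴ)) := by
    simp only [hDv, Matrix.conjTranspose_sum, Matrix.conjTranspose_sub, ← Finset.sum_sub_distrib]
    refine Finset.sum_congr rfl fun κ _ => ?_
    abel
  rw [← hre]
  exact hgoal

/-- **THE EXACT LATTICE LANDAU GAUGE EXISTS** (every `d`, `P ≥ 1`, every `P`-periodic `U`, every `n`): a unitary `P`-periodic `u` with `u 0 = 1`
minimising the trace link functional, whose representative `W = U^{u}` satisfies the lattice Landau condition on the odd part of its links at EVERY site —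
§2 + §3.  The SUP letter of `W` is NOT claimed. [folklore] -/
theorem exists_latticeLandauGauge [Nonempty n] {P : ℕ} (hP : 1 ≤ P) {U : Site d → Fin d → (Matrix n n ℂ)ˣ} (hUP : IsPeriodicCfg U (P : ℤ)) :
    ∃ u : Site d → (Matrix n n ℂ)ˣ, (∀ x, u x ∈ unitaryUnits (Matrix n n ℂ)) ∧ (∀ (x : Site d) (τ : Fin d), u (x + (P : ℤ) • e τ) = u x) ∧
      u 0 = 1 ∧
      (∀ v : Site d → (Matrix n n ℂ)ˣ, (∀ x, v x ∈ unitaryUnits (Matrix n n ℂ)) → (∀ (x : Site d) (τ : Fin d), v (x + (P : ℤ) • e τ) = v x) →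
        v 0 = 1 →
        ∑ x ∈ periodBox (d := d) P, ∑ κ : Fin d, (1 - nReTr ((gaugeAct u U x κ : (Matrix n n ℂ)ˣ) : Matrix n n ℂ))
          ≤ ∑ x ∈ periodBox (d := d) P, ∑ κ : Fin d, (1 - nReTr ((gaugeAct v U x κ : (Matrix n n ℂ)ˣ) : Matrix n n ℂ))) ∧
      ∀ z : Site d, ∑ κ : Fin d, ((((gaugeAct u U z κ : (Matrix n n ℂ)ˣ) : Matrix n n ℂ) - ((gaugeAct u U z κ : (Matrix n n ℂ)ˣ) : Matrix n n ℂ)ᴴ)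
        - (((gaugeAct u U (z - e κ) κ : (Matrix n n ℂ)ˣ) : Matrix n n ℂ) - ((gaugeAct u U (z - e κ) κ : (Matrix n n ℂ)ˣ) : Matrix n n ℂ)ᴴ)) = 0 := by
  haveI : NeZero P := ⟨by omega⟩
  obtain ⟨u, hu, huP, hu0, hmin⟩ := exists_traceLinkMinimiser P U
  exact ⟨u, hu, huP, hu0, hmin, landau_of_isMin hP hUP hu huP hu0 hmin⟩

end

end Summit.QuantumFields.BalabanUV.T4Continuum.NE7LatticeLandauEuler
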